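import Mathlib
import Summits.MatrixMultiplication.MatrixMultiplication.Theorems.SnSubsetDichotomyPolynomialSlackSplitBCAtoms
import Summits.MatrixMultiplication.MatrixMultiplication.Theorems.SnSubsetDichotomyPolynomialSlackOneDenseSharp
import Summits.MatrixMultiplication.MatrixMultiplication.Theorems.SnSubsetDichotomyPolynomialSlackStructure
import Summits.MatrixMultiplication.MatrixMultiplication.Theorems.SnSubsetDichotomyPolynomialSlackStubSplit
import Literature.Combinatorics.Additive.TPPGroupAlgebra

/-!
# One dense quotient: the ATOMS explicit volume bound

Crux `Summit.MatrixMultiplication.MatrixMultiplication.Theses.SnSubsetDichotomy.PolynomialSlack`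
(item `stmt-MatrixMultiplication-8306`), level-one programme, lead c9 (programme B, the atoms endgame),
line transport-split-hull. The atoms analogue of `volume_le_of_one_dense_sharp` (file `…OneDenseSharp`):
in the labelling where `A = S⁻¹T` is dense (`K_A = n!/(|S||T|) < 16M`) and `B = T⁻¹U`, `C = U⁻¹S` are
not (`K_B, K_C ≥ 16M`), a parity-pure TPP triple `S, T, U ⊆ S_n` (`n ≥ 40`) with `F := n!√(n!)/N ≤ 8n`
(`N = |S||T||U|`), `F² ≤ n^{1.34}` and `1 ≤ M ≤ n⁴` satisfies, for every bound `B` on the TPP volumes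
of `S_{n-1}`,

  `|S||T||U| ≤ 2·10³⁵·Λ⁶·G⁸·log²(8000·Λ·16n⁴)·n^{1.49}·B`,   `G = 1 + log n`, `Λ = 1200G²`,

as soon as `F(√6/√(n(n-1)) + 30√(6G²/M)/√(n-1)) ≤ 1/1000` and the four ranges `E1, E3, E4, E5` of
`Λ = 1200G²` against `n` hold (`volume_le_of_one_dense_atoms`). Proof: feed
`volume_le_of_split_BC_atoms` with the pair-log parameter `L = 6G` (valid as `K_B, K_C ≤ F² ≤ 64n²`,
so `4n·K_X ≤ 256n³ ≤ e⁶n⁶`), `Λ = 200·G·L = 1200G²`, the level-one error bound `levelOneError_le`,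
the co-density cap `K_B K_C = F²/K_A ≤ F² ≤ n^{1.34}`, and the monotonicity `K_A < 16M ≤ 16n⁴` inside
the two logarithms.
-/

namespace Summit.MatrixMultiplication.MatrixMultiplication.Theorems.PolynomialSlack

open scoped BigOperators
open Literature.Combinatorics.Additive (TripleProductProperty)

-- `Summit.<Summit>.<Problem>` is the tree's mandated summit-side namespace (CONVENTIONS §2); for
-- this single-conjunct summit the two coincide, so each declaration silences `dupNamespace`.
set_option linter.dupNamespace false

/-- **One dense quotient, atoms explicit form** (registered sub-goal `volume_le_of_one_dense_atoms` of
programme B, the atoms endgame). In the labelling where `A = S⁻¹T` is dense (`K_A < 16M`) and `B = T⁻¹U`,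
`C = U⁻¹S` are not (`K_B, K_C ≥ 16M`), a parity-pure TPP triple of non-empty subsets of `S_n` (`n ≥ 40`)
with `1 ≤ M ≤ n⁴`, `F = n!√(n!)/N ≤ 8n`, `F² ≤ n^{1.34}`, the smallness condition
`F(√6/√(n(n-1)) + 30√((1+log n)(6(1+log n))/M)/√(n-1)) ≤ 1/1000` and the four ranges `E1, E3, E4, E5`
of `Λ = 1200(1+log n)²` against `n` satisfies
`|S||T||U| ≤ 2·10³⁵·Λ⁶·(1+log n)⁸·log²(8000·Λ·16n⁴)·n^{1.49}·B` for every bound `B` on the TPP volumes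
of `S_{n-1}`. [folklore] -/
theorem volume_le_of_one_dense_atoms {n : ℕ} (hn : 40 ≤ n) (B : ℕ)
    (hB : ∀ S' T' U' : Finset (Equiv.Perm (Fin (n - 1))), TripleProductProperty S' T' U' →
      S'.card * T'.card * U'.card ≤ B)
    {S T U : Finset (Equiv.Perm (Fin n))} (hTPP : TripleProductProperty S T U)
    (hS0 : S.Nonempty) (hT0 : T.Nonempty) (hU0 : U.Nonempty)
    (hS : ∀ s ∈ S, ∀ s' ∈ S, Equiv.Perm.sign s = Equiv.Perm.sign s')
    (hT : ∀ t ∈ T, ∀ t' ∈ T, Equiv.Perm.sign t = Equiv.Perm.sign t')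
    (hU : ∀ u ∈ U, ∀ u' ∈ U, Equiv.Perm.sign u = Equiv.Perm.sign u')
    (M : ℝ) (hM : 1 ≤ M) (hMn : M ≤ (n : ℝ) ^ 4)
    (hKA : (n.factorial : ℝ) / (S.card * T.card : ℕ) < 16 * M)
    (hKB : 16 * M ≤ (n.factorial : ℝ) / (T.card * U.card : ℕ))
    (hKC : 16 * M ≤ (n.factorial : ℝ) / (U.card * S.card : ℕ))
    (hF : (n.factorial : ℝ) * Real.sqrt (n.factorial : ℝ) / (S.card * T.card * U.card : ℕ) ≤ 8 * n)
    (hsmall : (n.factorial : ℝ) * Real.sqrt (n.factorial : ℝ) / (S.card * T.card * U.card : ℕ) *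
        (Real.sqrt 6 / Real.sqrt ((n : ℝ) * ((n : ℝ) - 1)) +
          30 * Real.sqrt ((1 + Real.log n) * (6 * (1 + Real.log n)) / M) / Real.sqrt ((n : ℝ) - 1)) ≤
        1 / 1000)
    (hF134 : ((n.factorial : ℝ) * Real.sqrt (n.factorial : ℝ) / (S.card * T.card * U.card : ℕ)) ^ 2 ≤
      (n : ℝ) ^ (134 / 100 : ℝ))
    (hE1 : Real.log (2 * 10 ^ 10 * (1200 * (1 + Real.log n) ^ 2) ^ 2 * n * (1 + Real.log n) *
        Real.log (8000 * (1200 * (1 + Real.log n) ^ 2) * (16 * (n : ℝ) ^ 4))) ≤ 101 / 100 * Real.log n)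
    (hE3 : 8 * 10 ^ 8 * (1200 * (1 + Real.log n) ^ 2) ^ 4 * (1 + Real.log n) ^ 2 ≤ (n : ℝ))
    (hE4 : 16 * Real.log (160000 * (1200 * (1 + Real.log n) ^ 2) * (1 + Real.log n)) + 4 ≤
      5 / 1000 * Real.log n)
    (hE5 : Real.log (40000 * (1200 * (1 + Real.log n) ^ 2) ^ 2 * (1 + Real.log n)) ≤
      45 / 1000 * Real.log n) :
    ((S.card * T.card * U.card : ℕ) : ℝ) ≤
      2 * 10 ^ 35 * (1200 * (1 + Real.log n) ^ 2) ^ 6 * (1 + Real.log n) ^ 8 *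
        (Real.log (8000 * (1200 * (1 + Real.log n) ^ 2) * (16 * (n : ℝ) ^ 4))) ^ 2 *
          (n : ℝ) ^ (149 / 100 : ℝ) * B := by
  classical
  /- scalars -/
  have hn2 : 2 ≤ n := by omega
  have hnR : (40 : ℝ) ≤ n := by exact_mod_cast hn
  have hn0 : (0 : ℝ) < n := by linarith
  have hM0 : 0 < M := by linarith
  have hf0 : (0 : ℝ) < n.factorial := by exact_mod_cast n.factorial_pos
  have hlog0 : 0 ≤ Real.log n := Real.log_nonneg (by linarith)
  -- pair sizes and the volume
  have hα0 : (0 : ℝ) < (S.card * T.card : ℕ) := by exact_mod_cast Nat.mul_pos hS0.card_pos hT0.card_pos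
  have hβ0 : (0 : ℝ) < (T.card * U.card : ℕ) := by exact_mod_cast Nat.mul_pos hT0.card_pos hU0.card_pos
  have hγ0 : (0 : ℝ) < (U.card * S.card : ℕ) := by exact_mod_cast Nat.mul_pos hU0.card_pos hS0.card_pos
  have hN0 : (0 : ℝ) < (S.card * T.card * U.card : ℕ) := by
    exact_mod_cast Nat.mul_pos (Nat.mul_pos hS0.card_pos hT0.card_pos) hU0.card_pos
  have hαle : ((S.card * T.card : ℕ) : ℝ) ≤ n.factorial := by
    exact_mod_cast card_mul_card_le_factorial_of_injOn (injOn_quot_first hTPP hU0)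
  have hprod : ((S.card * T.card : ℕ) : ℝ) * (T.card * U.card : ℕ) * (U.card * S.card : ℕ) =
      ((S.card * T.card * U.card : ℕ) : ℝ) ^ 2 := by
    push_cast; ring
  /- the abbreviations `G, N, F, Λ` -/
  set G : ℝ := 1 + Real.log n with hG
  have hG1 : 1 ≤ G := by rw [hG]; linarith
  have hG0 : 0 < G := by linarith
  set N : ℝ := ((S.card * T.card * U.card : ℕ) : ℝ) with hN
  set F : ℝ := (n.factorial : ℝ) * Real.sqrt (n.factorial : ℝ) / N with hFdef
  have hF0 : 0 < F := by rw [hFdef]; positivity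
  set Λ : ℝ := 1200 * G ^ 2 with hΛ
  have hΛ1 : 1 ≤ Λ := by rw [hΛ]; nlinarith
  have hΛ0 : 0 < Λ := by linarith
  have hL1 : (1 : ℝ) ≤ 6 * G := by linarith
  have hΛle : 200 * G * (6 * G) ≤ Λ := by rw [hΛ]; exact le_of_eq (by ring)
  /- the co-densities: `K_A K_B K_C = F²`, `1 ≤ K_X ≤ F² ≤ 64 n²` -/
  have hKKK : (n.factorial : ℝ) / (S.card * T.card : ℕ) * ((n.factorial : ℝ) / (T.card * U.card : ℕ)) *
      ((n.factorial : ℝ) / (U.card * S.card : ℕ)) = F ^ 2 := by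
    rw [hFdef, div_pow, mul_pow, Real.sq_sqrt hf0.le, ← hprod]
    field_simp
  have hKA1 : 1 ≤ (n.factorial : ℝ) / (S.card * T.card : ℕ) := by
    rw [le_div_iff₀ hα0]; linarith
  have hKB1 : 1 ≤ (n.factorial : ℝ) / (T.card * U.card : ℕ) := by linarith
  have hKC1 : 1 ≤ (n.factorial : ℝ) / (U.card * S.card : ℕ) := by linarith
  have hF2 : F ^ 2 ≤ 64 * (n : ℝ) ^ 2 := (pow_le_pow_left₀ hF0.le hF 2).trans_eq (by ring)
  have hKBC : (n.factorial : ℝ) / (T.card * U.card : ℕ) * ((n.factorial : ℝ) / (U.card * S.card : ℕ)) ≤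
      F ^ 2 := by
    rw [← hKKK]
    have h0 : 0 ≤ (n.factorial : ℝ) / (T.card * U.card : ℕ) * ((n.factorial : ℝ) / (U.card * S.card : ℕ)) :=
      by positivity
    calc (n.factorial : ℝ) / (T.card * U.card : ℕ) * ((n.factorial : ℝ) / (U.card * S.card : ℕ))
        = 1 * ((n.factorial : ℝ) / (T.card * U.card : ℕ) * ((n.factorial : ℝ) / (U.card * S.card : ℕ))) :=
          (one_mul _).symm
      _ ≤ (n.factorial : ℝ) / (S.card * T.card : ℕ) *
          ((n.factorial : ℝ) / (T.card * U.card : ℕ) * ((n.factorial : ℝ) / (U.card * S.card : ℕ))) :=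
          mul_le_mul_of_nonneg_right hKA1 h0
      _ = _ := by ring
  have hKBF : (n.factorial : ℝ) / (T.card * U.card : ℕ) ≤ F ^ 2 := by
    refine le_trans ?_ hKBC
    have h2 := mul_le_mul_of_nonneg_left hKC1 (zero_le_one.trans hKB1)
    rwa [mul_one] at h2
  have hKCF : (n.factorial : ℝ) / (U.card * S.card : ℕ) ≤ F ^ 2 := by
    refine le_trans ?_ hKBC
    have h2 := mul_le_mul_of_nonneg_right hKB1 (zero_le_one.trans hKC1)
    rwa [one_mul] at h2
  /- the pair logarithms `≤ L = 6G` -/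
  have hlogK : ∀ ζ : ℝ, 0 < ζ → (n.factorial : ℝ) / ζ ≤ F ^ 2 →
      Real.log (4 * n * n.factorial / ζ) ≤ 6 * G := by
    intro ζ hζ hKF
    have e : 4 * (n : ℝ) * n.factorial / ζ = 4 * n * ((n.factorial : ℝ) / ζ) := by ring
    rw [e]
    have hle : 4 * (n : ℝ) * ((n.factorial : ℝ) / ζ) ≤ 256 * (n : ℝ) ^ 3 :=
      calc 4 * (n : ℝ) * ((n.factorial : ℝ) / ζ) ≤ 4 * n * (64 * (n : ℝ) ^ 2) :=
            mul_le_mul_of_nonneg_left (hKF.trans hF2) (by positivity)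
        _ = 256 * (n : ℝ) ^ 3 := by ring
    have h0 : 0 < 4 * (n : ℝ) * ((n.factorial : ℝ) / ζ) := by positivity
    calc Real.log (4 * (n : ℝ) * ((n.factorial : ℝ) / ζ)) ≤ 6 + (3 : ℕ) * Real.log n :=
          oneDenseSharp_log_le 3 hn0 h0 (by norm_num) hle oneDenseSharp_exp_six
      _ ≤ 6 * G := by rw [hG]; push_cast; linarith
  have hLB : Real.log (4 * n * n.factorial / (T.card * U.card : ℕ)) ≤ 6 * G := hlogK _ hβ0 hKBF
  have hLC : Real.log (4 * n * n.factorial / (U.card * S.card : ℕ)) ≤ 6 * G := hlogK _ hγ0 hKCF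
  /- the level-one error -/
  have herr : (n.factorial : ℝ) / (2 * N) +
      (n.factorial : ℝ) * Real.sqrt (n.factorial : ℝ) / (2 * N * Real.sqrt (((n * (n - 1) : ℕ) : ℝ) / 6)) +
      3 * Real.sqrt (100 * G * (6 * G) / M) * F / Real.sqrt ((n : ℝ) - 1) ≤
      F * (Real.sqrt 6 / Real.sqrt ((n : ℝ) * ((n : ℝ) - 1)) +
        30 * Real.sqrt (G * (6 * G) / M) / Real.sqrt ((n : ℝ) - 1)) :=
    levelOneError_le hn2 N G (6 * G) M hN0
  have hsm : (n.factorial : ℝ) / (2 * N) +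
      (n.factorial : ℝ) * Real.sqrt (n.factorial : ℝ) / (2 * N * Real.sqrt (((n * (n - 1) : ℕ) : ℝ) / 6)) +
      3 * Real.sqrt (100 * G * (6 * G) / M) * F / Real.sqrt ((n : ℝ) - 1) ≤ 1 / 1000 := by
    linarith [herr, hsmall]
  /- the co-density cap `log(K_B K_C) ≤ log F² ≤ 1.34 log n` -/
  have hQ : Real.log ((n.factorial : ℝ) / (T.card * U.card : ℕ) * ((n.factorial : ℝ) / (U.card * S.card : ℕ))) ≤
      134 / 100 * Real.log n := by
    have h0 : 0 < (n.factorial : ℝ) / (T.card * U.card : ℕ) * ((n.factorial : ℝ) / (U.card * S.card : ℕ)) := by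
      positivity
    calc Real.log ((n.factorial : ℝ) / (T.card * U.card : ℕ) * ((n.factorial : ℝ) / (U.card * S.card : ℕ)))
        ≤ Real.log ((n : ℝ) ^ (134 / 100 : ℝ)) := Real.log_le_log h0 (hKBC.trans hF134)
      _ = 134 / 100 * Real.log n := Real.log_rpow hn0 _
  /- the monotonicity `K_A < 16M ≤ 16 n⁴` inside the logarithms -/
  have hKA16 : (n.factorial : ℝ) / (S.card * T.card : ℕ) ≤ 16 * (n : ℝ) ^ 4 := by linarith
  have hin0 : 0 < 8000 * Λ * ((n.factorial : ℝ) / (S.card * T.card : ℕ)) := by positivity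
  have hin1 : 1 < 8000 * Λ * ((n.factorial : ℝ) / (S.card * T.card : ℕ)) := by
    have : (1 : ℝ) ≤ Λ * ((n.factorial : ℝ) / (S.card * T.card : ℕ)) := one_le_mul_of_one_le_of_one_le hΛ1 hKA1
    linarith
  have hlogA0 : 0 < Real.log (8000 * Λ * ((n.factorial : ℝ) / (S.card * T.card : ℕ))) := Real.log_pos hin1
  have hlogA : Real.log (8000 * Λ * ((n.factorial : ℝ) / (S.card * T.card : ℕ))) ≤
      Real.log (8000 * Λ * (16 * (n : ℝ) ^ 4)) :=
    Real.log_le_log hin0 (mul_le_mul_of_nonneg_left hKA16 (by positivity))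
  have hE1' : Real.log (2 * 10 ^ 10 * Λ ^ 2 * n * G *
      Real.log (8000 * Λ * ((n.factorial : ℝ) / (S.card * T.card : ℕ)))) ≤ 101 / 100 * Real.log n := by
    refine le_trans (Real.log_le_log (mul_pos (by positivity) hlogA0) ?_) hE1
    exact mul_le_mul_of_nonneg_left hlogA (by positivity)
  /- the split bound -/
  have hvol : N ≤ 2 * 10 ^ 35 * Λ ^ 6 * G ^ 8 *
      (Real.log (8000 * Λ * ((n.factorial : ℝ) / (S.card * T.card : ℕ)))) ^ 2 * (n : ℝ) ^ (149 / 100 : ℝ) * B :=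
    volume_le_of_split_BC_atoms hn B hB hTPP hS0 hT0 hU0 hS hT hU M (6 * G) Λ hM hL1 hΛle hKB hKC hLB hLC hsm
      hQ hE1' hE3 hE4 hE5
  /- the output conversion: `log²(8000 Λ K_A) ≤ log²(8000 Λ 16n⁴)` -/
  have hsq : (Real.log (8000 * Λ * ((n.factorial : ℝ) / (S.card * T.card : ℕ)))) ^ 2 ≤
      (Real.log (8000 * Λ * (16 * (n : ℝ) ^ 4))) ^ 2 := pow_le_pow_left₀ hlogA0.le hlogA 2
  refine hvol.trans ?_
  have hB0 : (0 : ℝ) ≤ B := Nat.cast_nonneg _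
  have h0 : (0 : ℝ) ≤ 2 * 10 ^ 35 * Λ ^ 6 * G ^ 8 := by positivity
  exact mul_le_mul_of_nonneg_right (mul_le_mul_of_nonneg_right (mul_le_mul_of_nonneg_left hsq h0)
    (Real.rpow_nonneg hn0.le _)) hB0

end Summit.MatrixMultiplication.MatrixMultiplication.Theorems.PolynomialSlack
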